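import Summits.ABC.IUTFork.Repair.RHHeightScalingSRM
import HarnessLib

/-!
# R-H ROUND-3 AXIS D2, class «SRM» — DATUM LEVEL: the weighted place sum of the SRM object is pinned in a height-free band while the
# weighted trivial mass is `s`-linear under the dilation `m_q ↦ s·m_q`; the datum's recovered fraction is `Θ(s⁻¹)` — exponent `−1`

PROOF-ONLY sequel (0 definitions, 0 `Prop` facts, no instance, no notation) of this seat's `RHHeightScalingSRM` (p532290), abc-iut cell, rung
LADDER-ABC:A2.RESCUE.H, seat abc-iut-rh2-q2-eq (gen 8), KEY `D2-EXP-2` (desk `plan/rescue/R-H/ROUND3/AXIS-CD-DESK.md` §D2: «recovered fraction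
f_X(h) := (mass financed by objects of class X) / T(h)» at the DATUM; rulings R81 (G1 constant kinds) / R82 (a): «rows EXP-2 / EXP-4 cite the
∀ s ≥ 1 CERTIFIED height-free cap C₁ := Σ_w u_w Σ_{j≥2}(jδ_w + (j+1)G_w + e_w − 1)/M₁»).

THE DATUM: a finite set `W` of bad places (index type `ι`), WEIGHTS `u_w ≥ 0` (print's `ln p_w/(l⋆·e_w)`, real), per place the integers of
`RHHeightScalingSRM` (`e_w > 0`, `δ_w ≥ 0`, `R_out,w ≤ R_in,w`, bed depth `m₁,w = m_q(w)`), a common label count `n + 1 = l⋆`, and a common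
INTEGER dilation `s ≥ 1` (`m_w = s·m₁,w`; FINAL (1)(e)). Weighted SRM `Σ_w u_w·SRM_w(m_w)`, weighted mass `Σ_w u_w·MASS_w(m_w)` (`= M(s) = s·M₁`,
`6·M₁ = S′·Σ_w u_w m₁,w`, `S′ = (n+1)(n+2)(2n+3) − 6(n+1)`).

WHAT IS PROVED (namespace `Summit.ABC.IUTFork.Repair.RH.HeightScalingSRM`, appended section `Datum`): `weighted_srm_le` «at ANY depths
`6·Σ u_w SRM_w(m_w) ≤ Σ u_w B_w`, `B_w = 3n(n+3)δ_w + 3n(n+5)G_w + 6n(e_w−1)`» (the datum's C₁·6M₁ — ∀-kind, R82 (a)); `le_weighted_srm_of_saturated`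
«every place saturated (`2δ_w + 3G_w + e_w ≤ 3m_w`) ⟹ `Σ u_w A_w ≤ 6·Σ u_w SRM_w(m_w)`, `A_w = B_w − 6n(e_w−1)`»; `six_mul_weighted_mass_dilate`
«`6·Σ u_w MASS_w(s·m₁,w) = s·S′·Σ u_w m₁,w`» (the mass is EXACTLY linear in the dilation); and THE DATUM EXPONENT over `ℝ`:
**`weighted_srm_div_mass_le`** «`1 ≤ s`, `0 < Σ u_w m₁,w`, `1 ≤ n` ⟹ f(s) := Σ u SRM(s·m₁)/Σ u MASS(s·m₁) ≤ (Σ u_w B_w)/(s·S′·Σ u_w m₁,w)`» and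
**`le_weighted_srm_div_mass_of_saturated`** «… ∧ every place saturated at `s` ⟹ `(Σ u_w A_w)/(s·S′·Σ u_w m₁,w) ≤ f(s)`»: `f(s) = Θ(s⁻¹)` with the
explicit height-free constants `C₁ = Σu B/(S′Σu m₁)` (∀ s ≥ 1) and `ĉ⁻ = Σu A/(S′Σu m₁)` (s ≥ s_sat) — the typed form of row EXP-2's
«e_SRM = −1 exactly; constant ∈ [ĉ⁻, C₁]» (bed values FREY133 [1.861, 1.918] · HEX79 [3.607, 3.750] · FREY482 [1.996, 2.016] pooled;
R/ROUND3/AXIS-D2/D2-EXP-2-SRM-rh2-q2-eq.md). Dividing by `T(s) = M(s) − Tol` instead of `M(s)` multiplies by `M/T → 1` (MIN-SLICE (ii)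
`RH.SigmaMass.massThreshold`); not restated.
HONEST FRAMING: finite weighted sums of the integer place theorems, nothing more; which genuine datum carries which `(W, u, e, δ, R_in, R_out, m₁)`
is the kit tables' audit (computed ≠ proved); the dilation is the WINDOW MODEL of FINAL (1)(e), not an operation on genuine data; nothing here
decides any cell at genuine data, asserts or denies [IUTchIII] Cor. 3.12 / [IUTchIV] Thm 1.10, or bears on abc; no side taken on any author;
typed ≠ proved. [cite: Mochizuki2012, IUTchIV Prop. 1.2 (i)(ii) p. 10, Thm. 1.10 Step (v) p. 27–28] [cite: DupuyHilado2025, §4.12]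
[claim: Mochizuki2012, status: disputed] for every quoted construction.
-/

namespace Summit.ABC.IUTFork.Repair.RH.HeightScalingSRM

/-! ## §5. Datum level: weighted finite sums over the bad places -/

section Datum

variable {ι : Type*} (W : Finset ι) (u : ι → ℝ) (e δ Rin Rout : ι → ℤ)

/-- **THE DATUM'S ∀-HEIGHT CEILING (C₁·6M₁)**: at ANY depths `m_w`, `6·Σ_w u_w·SRM_w(m_w) ≤ Σ_w u_w·(3n(n+3)δ_w + 3n(n+5)G_w + 6n(e_w−1))`
(`u_w ≥ 0`, `e_w > 0`, `δ_w ≥ 0`, `R_out,w ≤ R_in,w` on `W`) — the weighted sum of `srm_le`. This is R82 (a)'s certified cap `C₁` times `6M₁`,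
valid at every dilation `s ≥ 1` (indeed at every depth). [cite: DupuyHilado2025, §4.12] [claim: Mochizuki2012, status: disputed] -/
theorem weighted_srm_le (hu : ∀ w ∈ W, 0 ≤ u w) (he : ∀ w ∈ W, 0 < e w) (hδ : ∀ w ∈ W, 0 ≤ δ w)
    (hio : ∀ w ∈ W, Rout w ≤ Rin w) (m : ι → ℤ) (n : ℕ) :
    6 * ∑ w ∈ W, u w * (((∑ k ∈ Finset.range (n + 1),
          (if 0 < e w * ((((k : ℤ) + 1) ^ 2 * m w - ((k : ℤ) + 1) * δ w - ((k : ℤ) + 1 + 1) * Rin w) / e w) + ((k : ℤ) + 1 + 1) * Rout w - m w then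
            (((k : ℤ) + 1) ^ 2 - 1) * m w -
              (e w * ((((k : ℤ) + 1) ^ 2 * m w - ((k : ℤ) + 1) * δ w - ((k : ℤ) + 1 + 1) * Rin w) / e w) + ((k : ℤ) + 1 + 1) * Rout w - m w)
          else 0)) : ℤ) : ℝ)
      ≤ ∑ w ∈ W, u w * (((3 * (n : ℤ) * (n + 3) * δ w + 3 * (n : ℤ) * (n + 5) * (Rin w - Rout w) + 6 * (n : ℤ) * (e w - 1)) : ℤ) : ℝ) := by
  rw [Finset.mul_sum]
  apply Finset.sum_le_sum
  intro w hw
  have h := srm_le (m w) (e w) (δ w) (Rin w) (Rout w) (he w hw) (hδ w hw) (hio w hw) n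
  have h1 := (Int.cast_le (R := ℝ)).mpr h
  rw [Int.cast_mul, Int.cast_ofNat] at h1
  have h2 := mul_le_mul_of_nonneg_left h1 (hu w hw)
  linarith

/-- **THE DATUM'S SATURATED LOWER BRACKET**: if every place of `W` is saturated at its depth (`2δ_w + 3G_w + e_w ≤ 3m_w`), then
`Σ_w u_w·(3n(n+3)δ_w + 3n(n+5)G_w) ≤ 6·Σ_w u_w·SRM_w(m_w)` — the weighted sum of `le_srm_of_saturated`. With `weighted_srm_le`: past the
datum's saturation dilation the weighted SRM is pinned in a HEIGHT-FREE band (width = the residue term `Σ_w u_w·6n(e_w−1)`).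
[cite: DupuyHilado2025, §4.12] [claim: Mochizuki2012, status: disputed] -/
theorem le_weighted_srm_of_saturated (hu : ∀ w ∈ W, 0 ≤ u w) (he : ∀ w ∈ W, 0 < e w) (hδ : ∀ w ∈ W, 0 ≤ δ w)
    (hio : ∀ w ∈ W, Rout w ≤ Rin w) (m : ι → ℤ) (hsat : ∀ w ∈ W, 2 * δ w + 3 * (Rin w - Rout w) + e w ≤ 3 * m w) (n : ℕ) :
    ∑ w ∈ W, u w * (((3 * (n : ℤ) * (n + 3) * δ w + 3 * (n : ℤ) * (n + 5) * (Rin w - Rout w)) : ℤ) : ℝ)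
      ≤ 6 * ∑ w ∈ W, u w * (((∑ k ∈ Finset.range (n + 1),
          (if 0 < e w * ((((k : ℤ) + 1) ^ 2 * m w - ((k : ℤ) + 1) * δ w - ((k : ℤ) + 1 + 1) * Rin w) / e w) + ((k : ℤ) + 1 + 1) * Rout w - m w then
            (((k : ℤ) + 1) ^ 2 - 1) * m w -
              (e w * ((((k : ℤ) + 1) ^ 2 * m w - ((k : ℤ) + 1) * δ w - ((k : ℤ) + 1 + 1) * Rin w) / e w) + ((k : ℤ) + 1 + 1) * Rout w - m w)
          else 0)) : ℤ) : ℝ) := by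
  rw [Finset.mul_sum]
  apply Finset.sum_le_sum
  intro w hw
  have h := le_srm_of_saturated (m w) (e w) (δ w) (Rin w) (Rout w) (he w hw) (hδ w hw) (hio w hw) (hsat w hw) n
  have h1 := (Int.cast_le (R := ℝ)).mpr h
  rw [Int.cast_mul, Int.cast_ofNat] at h1
  have h2 := mul_le_mul_of_nonneg_left h1 (hu w hw)
  linarith

/-- **THE WEIGHTED MASS IS EXACTLY LINEAR IN THE DILATION**: `6·Σ_w u_w·MASS_w(s·m₁,w) = s·S′·Σ_w u_w·m₁,w`,
`S′ = (n+1)(n+2)(2n+3) − 6(n+1)` (the weighted sum of `six_mul_mass` at `m_w = s·m₁,w`) — «`T ∝ h`» of FINAL (1)(d), to the letter for the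
trivial mass. [folklore] -/
theorem six_mul_weighted_mass_dilate (m₁ : ι → ℤ) (s : ℤ) (n : ℕ) :
    6 * ∑ w ∈ W, u w * (((∑ k ∈ Finset.range (n + 1), ((((k : ℤ) + 1) ^ 2 - 1) * (s * m₁ w))) : ℤ) : ℝ)
      = (s : ℝ) * (((((n : ℤ) + 1) * (n + 2) * (2 * n + 3) - 6 * (n + 1)) : ℤ) : ℝ) * ∑ w ∈ W, u w * ((m₁ w : ℤ) : ℝ) := by
  rw [Finset.mul_sum, Finset.mul_sum]
  apply Finset.sum_congr rfl
  intro w _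
  have h := six_mul_mass (s * m₁ w) n
  have h1 : ((6 * (∑ k ∈ Finset.range (n + 1), ((((k : ℤ) + 1) ^ 2 - 1) * (s * m₁ w))) : ℤ) : ℝ) = (((((n : ℤ) + 1) * (n + 2) * (2 * n + 3) - 6 * (n + 1)) * (s * m₁ w) : ℤ) : ℝ) := by
    exact_mod_cast h
  rw [Int.cast_mul, Int.cast_ofNat] at h1
  rw [← mul_assoc, mul_comm (6 : ℝ) (u w), mul_assoc, h1]
  push_cast
  ring

/-- **THE DATUM EXPONENT, UPPER SIDE (∀ s ≥ 1, constant `C₁`)**: for an integer dilation `s ≥ 1`, positive bed mass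
(`0 < Σ_w u_w m₁,w`), `1 ≤ n`, and the structural hypotheses on `W`, the datum's recovered fraction of the SRM class obeys
`f(s) := Σ_w u_w·SRM_w(s·m₁,w) / Σ_w u_w·MASS_w(s·m₁,w) ≤ (Σ_w u_w·B_w) / (s·S′·Σ_w u_w·m₁,w)` — a HEIGHT-FREE constant over `s`:
EXPONENT `−1` with R82 (a)'s ∀-certified constant `C₁ = Σ u B/(S′ Σ u m₁)`. [cite: DupuyHilado2025, §4.12] [claim: Mochizuki2012, status: disputed] -/
theorem weighted_srm_div_mass_le (hu : ∀ w ∈ W, 0 ≤ u w) (he : ∀ w ∈ W, 0 < e w) (hδ : ∀ w ∈ W, 0 ≤ δ w)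
    (hio : ∀ w ∈ W, Rout w ≤ Rin w) (m₁ : ι → ℤ) (hM : 0 < ∑ w ∈ W, u w * ((m₁ w : ℤ) : ℝ)) (n : ℕ) (hn : 1 ≤ n)
    (s : ℤ) (hs : 1 ≤ s) :
    (∑ w ∈ W, u w * (((∑ k ∈ Finset.range (n + 1),
          (if 0 < e w * ((((k : ℤ) + 1) ^ 2 * (s * m₁ w) - ((k : ℤ) + 1) * δ w - ((k : ℤ) + 1 + 1) * Rin w) / e w) + ((k : ℤ) + 1 + 1) * Rout w - (s * m₁ w) then
            (((k : ℤ) + 1) ^ 2 - 1) * (s * m₁ w) -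
              (e w * ((((k : ℤ) + 1) ^ 2 * (s * m₁ w) - ((k : ℤ) + 1) * δ w - ((k : ℤ) + 1 + 1) * Rin w) / e w) + ((k : ℤ) + 1 + 1) * Rout w - (s * m₁ w))
          else 0)) : ℤ) : ℝ))
        / (∑ w ∈ W, u w * (((∑ k ∈ Finset.range (n + 1), ((((k : ℤ) + 1) ^ 2 - 1) * (s * m₁ w))) : ℤ) : ℝ))
      ≤ (∑ w ∈ W, u w * (((3 * (n : ℤ) * (n + 3) * δ w + 3 * (n : ℤ) * (n + 5) * (Rin w - Rout w) + 6 * (n : ℤ) * (e w - 1)) : ℤ) : ℝ))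
        / ((s : ℝ) * (((((n : ℤ) + 1) * (n + 2) * (2 * n + 3) - 6 * (n + 1)) : ℤ) : ℝ) * ∑ w ∈ W, u w * ((m₁ w : ℤ) : ℝ)) := by
  have h6 := weighted_srm_le W u e δ Rin Rout hu he hδ hio (fun w => s * m₁ w) n
  have hmass := six_mul_weighted_mass_dilate W u m₁ s n
  have hS : (0 : ℤ) < (((n : ℤ) + 1) * (n + 2) * (2 * n + 3) - 6 * (n + 1)) := by
    have hn' : (0 : ℤ) < n := by exact_mod_cast hn
    have hfac : (((n : ℤ) + 1) * (n + 2) * (2 * n + 3) - 6 * (n + 1)) = ((n : ℤ) + 1) * n * (2 * n + 7) := by ring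
    rw [hfac]
    positivity
  have hS' : (0 : ℝ) < (((((n : ℤ) + 1) * (n + 2) * (2 * n + 3) - 6 * (n + 1)) : ℤ) : ℝ) := by exact_mod_cast hS
  have hs' : (1 : ℝ) ≤ (s : ℝ) := by exact_mod_cast hs
  have hden : (0 : ℝ) < (s : ℝ) * (((((n : ℤ) + 1) * (n + 2) * (2 * n + 3) - 6 * (n + 1)) : ℤ) : ℝ) * ∑ w ∈ W, u w * ((m₁ w : ℤ) : ℝ) := by positivity
  set N : ℝ := ∑ w ∈ W, u w * (((∑ k ∈ Finset.range (n + 1),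
          (if 0 < e w * ((((k : ℤ) + 1) ^ 2 * (s * m₁ w) - ((k : ℤ) + 1) * δ w - ((k : ℤ) + 1 + 1) * Rin w) / e w) + ((k : ℤ) + 1 + 1) * Rout w - (s * m₁ w) then
            (((k : ℤ) + 1) ^ 2 - 1) * (s * m₁ w) -
              (e w * ((((k : ℤ) + 1) ^ 2 * (s * m₁ w) - ((k : ℤ) + 1) * δ w - ((k : ℤ) + 1 + 1) * Rin w) / e w) + ((k : ℤ) + 1 + 1) * Rout w - (s * m₁ w))
          else 0)) : ℤ) : ℝ) with hN
  set D : ℝ := ∑ w ∈ W, u w * (((∑ k ∈ Finset.range (n + 1), ((((k : ℤ) + 1) ^ 2 - 1) * (s * m₁ w))) : ℤ) : ℝ) with hD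
  set Bt : ℝ := ∑ w ∈ W, u w * (((3 * (n : ℤ) * (n + 3) * δ w + 3 * (n : ℤ) * (n + 5) * (Rin w - Rout w) + 6 * (n : ℤ) * (e w - 1)) : ℤ) : ℝ) with hBt
  have hD6 : (s : ℝ) * (((((n : ℤ) + 1) * (n + 2) * (2 * n + 3) - 6 * (n + 1)) : ℤ) : ℝ) * ∑ w ∈ W, u w * ((m₁ w : ℤ) : ℝ) = 6 * D := hmass.symm
  have hDpos : 0 < D := by linarith
  rw [hD6, div_le_div_iff₀ hDpos (by linarith)]
  have h7 := mul_le_mul_of_nonneg_right h6 hDpos.le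
  linarith

/-- **THE DATUM EXPONENT, LOWER SIDE (s ≥ s_sat, constant `ĉ⁻`)**: if moreover every place of `W` is saturated at the dilation `s`
(`2δ_w + 3G_w + e_w ≤ 3·s·m₁,w`), then `(Σ_w u_w·A_w) / (s·S′·Σ_w u_w·m₁,w) ≤ f(s)`, `A_w = 3n(n+3)δ_w + 3n(n+5)G_w`. With
`weighted_srm_div_mass_le`: `f(s) = Θ(s⁻¹)` — the datum's recovered fraction of the SRM class has height exponent EXACTLY `−1`, constant in the
height-free band `[Σ u A, Σ u B]/(S′ Σ u m₁)` (row EXP-2's `[ĉ⁻, C₁]`). [cite: DupuyHilado2025, §4.12] [claim: Mochizuki2012, status: disputed] -/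
theorem le_weighted_srm_div_mass_of_saturated (hu : ∀ w ∈ W, 0 ≤ u w) (he : ∀ w ∈ W, 0 < e w) (hδ : ∀ w ∈ W, 0 ≤ δ w)
    (hio : ∀ w ∈ W, Rout w ≤ Rin w) (m₁ : ι → ℤ) (hM : 0 < ∑ w ∈ W, u w * ((m₁ w : ℤ) : ℝ)) (n : ℕ) (hn : 1 ≤ n)
    (s : ℤ) (hs : 1 ≤ s) (hsat : ∀ w ∈ W, 2 * δ w + 3 * (Rin w - Rout w) + e w ≤ 3 * (s * m₁ w)) :
    (∑ w ∈ W, u w * (((3 * (n : ℤ) * (n + 3) * δ w + 3 * (n : ℤ) * (n + 5) * (Rin w - Rout w)) : ℤ) : ℝ))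
        / ((s : ℝ) * (((((n : ℤ) + 1) * (n + 2) * (2 * n + 3) - 6 * (n + 1)) : ℤ) : ℝ) * ∑ w ∈ W, u w * ((m₁ w : ℤ) : ℝ))
      ≤ (∑ w ∈ W, u w * (((∑ k ∈ Finset.range (n + 1),
          (if 0 < e w * ((((k : ℤ) + 1) ^ 2 * (s * m₁ w) - ((k : ℤ) + 1) * δ w - ((k : ℤ) + 1 + 1) * Rin w) / e w) + ((k : ℤ) + 1 + 1) * Rout w - (s * m₁ w) then
            (((k : ℤ) + 1) ^ 2 - 1) * (s * m₁ w) -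
              (e w * ((((k : ℤ) + 1) ^ 2 * (s * m₁ w) - ((k : ℤ) + 1) * δ w - ((k : ℤ) + 1 + 1) * Rin w) / e w) + ((k : ℤ) + 1 + 1) * Rout w - (s * m₁ w))
          else 0)) : ℤ) : ℝ))
        / (∑ w ∈ W, u w * (((∑ k ∈ Finset.range (n + 1), ((((k : ℤ) + 1) ^ 2 - 1) * (s * m₁ w))) : ℤ) : ℝ)) := by
  have h6 := le_weighted_srm_of_saturated W u e δ Rin Rout hu he hδ hio (fun w => s * m₁ w) hsat n
  have hmass := six_mul_weighted_mass_dilate W u m₁ s n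
  have hS : (0 : ℤ) < (((n : ℤ) + 1) * (n + 2) * (2 * n + 3) - 6 * (n + 1)) := by
    have hn' : (0 : ℤ) < n := by exact_mod_cast hn
    have hfac : (((n : ℤ) + 1) * (n + 2) * (2 * n + 3) - 6 * (n + 1)) = ((n : ℤ) + 1) * n * (2 * n + 7) := by ring
    rw [hfac]
    positivity
  have hS' : (0 : ℝ) < (((((n : ℤ) + 1) * (n + 2) * (2 * n + 3) - 6 * (n + 1)) : ℤ) : ℝ) := by exact_mod_cast hS
  have hs' : (1 : ℝ) ≤ (s : ℝ) := by exact_mod_cast hs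
  have hden : (0 : ℝ) < (s : ℝ) * (((((n : ℤ) + 1) * (n + 2) * (2 * n + 3) - 6 * (n + 1)) : ℤ) : ℝ) * ∑ w ∈ W, u w * ((m₁ w : ℤ) : ℝ) := by positivity
  set N : ℝ := ∑ w ∈ W, u w * (((∑ k ∈ Finset.range (n + 1),
          (if 0 < e w * ((((k : ℤ) + 1) ^ 2 * (s * m₁ w) - ((k : ℤ) + 1) * δ w - ((k : ℤ) + 1 + 1) * Rin w) / e w) + ((k : ℤ) + 1 + 1) * Rout w - (s * m₁ w) then
            (((k : ℤ) + 1) ^ 2 - 1) * (s * m₁ w) -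
              (e w * ((((k : ℤ) + 1) ^ 2 * (s * m₁ w) - ((k : ℤ) + 1) * δ w - ((k : ℤ) + 1 + 1) * Rin w) / e w) + ((k : ℤ) + 1 + 1) * Rout w - (s * m₁ w))
          else 0)) : ℤ) : ℝ) with hN
  set D : ℝ := ∑ w ∈ W, u w * (((∑ k ∈ Finset.range (n + 1), ((((k : ℤ) + 1) ^ 2 - 1) * (s * m₁ w))) : ℤ) : ℝ) with hD
  set At : ℝ := ∑ w ∈ W, u w * (((3 * (n : ℤ) * (n + 3) * δ w + 3 * (n : ℤ) * (n + 5) * (Rin w - Rout w)) : ℤ) : ℝ) with hAt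
  have hD6 : (s : ℝ) * (((((n : ℤ) + 1) * (n + 2) * (2 * n + 3) - 6 * (n + 1)) : ℤ) : ℝ) * ∑ w ∈ W, u w * ((m₁ w : ℤ) : ℝ) = 6 * D := hmass.symm
  have hDpos : 0 < D := by linarith
  rw [hD6, div_le_div_iff₀ (by linarith) hDpos]
  have h7 := mul_le_mul_of_nonneg_right h6 hDpos.le
  linarith

end Datum

end Summit.ABC.IUTFork.Repair.RH.HeightScalingSRM
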